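import Summits.BirchSwinnertonDyer.BirchSwinnertonDyer.Theorems.PrintCf2SplitBadTwoControlCokernelTamagawa
import Summits.BirchSwinnertonDyer.BirchSwinnertonDyer.Theorems.PrintCf2SplitBadTwoTamagawaSevenDvd
import Summits.BirchSwinnertonDyer.BirchSwinnertonDyer.Theorems.PrintCf2SplitBadTwoLineNoSplitPrimes
import Summits.BirchSwinnertonDyer.BirchSwinnertonDyer.Theorems.PrintCf2SplitBadTwoTorsionSevenDvd
import HarnessLib

/-!
# Crux `PrintCf2.SplitBadTwoRankOneOfFacts` (stmt-BirchSwinnertonDyer-20368), road α v10.3 (stub S3c) — brick B16-TAM-7, file 2: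
# `#{w : 2 ∉ w, 7d ∈ w} + 2 = v₂ Tam(W)` and its control corollaries for EVERY squarefree `d ≢ 1 (mod 4)` (the hypothesis `7 ∤ d` of p663318 removed)

Cell `bsd-print-cf2`, width seat `bsd-line-cf2-p1-w3` g8 (prover-bsd-line-cf2-p1-w3-g8-0). `--supports stmt-BirchSwinnertonDyer-20368`
(helper, Theses-free). HONEST FRAMING: nothing here closes the crux or a registered stub; BSD is not proved by any of this; no summit
statement is proved by this seat. No definition, no named fact, no `sorry`.

WHAT (for EVERY member — `C • W = cm7^{(d)}`, `d` squarefree, `d ≢ 1 (mod 4)`, with or without `7 ∣ d`; `K` imaginary quadratic with `θ² = −7`;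
`T = {w : 2 ∉ w, 7d ∈ w}`): `padicValNat_two_tamagawaProduct_eq` (`v₂ Tam(W) = 3 + Σ_{ℓ ∈ primeFactors|d| ∖ {2,7}} (1 | 2)`: c301's law for `7 ∤ d`,
file 1 for `7 ∣ d`), `card_places_seven_mul_eq_erase` (`#T = 1 + Σ…`, decomposition law in `ℚ(√−7)`),
**`card_places_add_two_eq_padicValNat_tamagawaProduct'`** (`#T + 2 = v₂ Tam(W)`), and the S3c-facing corollaries
**`padicValNat_two_relIndex_control_of_frame_le_tamagawaProduct'`** (`v₂ [𝔖_{v̄}(K*_∞, W*)^Γ : res 𝔖_{v̄}(K, W*)] ≤ v₂ Tam(W)`) and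
**`sum_padicValNat_localKer_top_of_frame_add_two_eq'`** (`Σ_{w ∈ T} v₂ #LK_w + 2 = v₂ Tam(W)` under (C1) «no `w ∈ T` splits completely in
`K*_∞`», the displayed hypothesis `hC1`). With these, the `padicValNat 2 W.tamagawaProduct` summand of S3c's right-hand side comes BY NAME from the
odd local kernels of the cokernel of Agboola's control map on the WHOLE class. §4 UNCONDITIONAL forms: the hypothesis (C1) is this seat's
theorem `LineDecomposition.decomp_not_le_kerSubgroup_of_isUnramifiedOutside` (idelic class field theory, `…LineNoSplitPrimes`), so on every
frame with BOTH places `v ≠ v̄` above `2` named: `frame_not_decomp_le_kerSubgroup` (every `w` with `2 ∉ w`), **`natCard_localKer_top_of_frame_eq_two'`**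
(`#LK_w = 2` at every `w ∤ 2` with `7d ∈ w`, NO hypothesis on `D_w`), **`prod_natCard_localKer_top_of_frame_eq_two_pow'`** and
**`sum_padicValNat_localKer_top_of_frame_add_two_eq''`** (`Σ_{w ∈ T} v₂ #LK_w + 2 = v₂ Tam(W)` with NO displayed hypothesis).
§5 FOR LEAD g12's CUT 4 (`restrictedControl_two_of_residuals_split_places`, p66xxxx): its hypotheses **(C1-split)** and **(R-SEVEN)** VERBATIM as
closed theorems `c1_split_cut4`, `rSeven_cut4` (torsion half from `…TorsionSevenDvd`), to be passed BY NAME.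
presearch: Greenberg LNM 1716 §3 Lemma 3.3 / p. 88, Agboola 2007 §6 — held; tree: p663318 + file 1 reused BY NAME. No fact filed. beyond-print theorem: no.

References: [GreenbergLNM1716] §3 Lemma 3.3, p. 88; [Agboola2007] §3 Prop. 3.2, §6; [Marcus2018] Ch. 3 Thm. 25; [Silverman1994] IV.9.4, Table 4.1.
-/

noncomputable section

open scoped Classical NumberField

set_option linter.dupNamespace false
set_option autoImplicit false

open WeierstrassCurve IsDedekindDomain IsLocalRing Rat.HeightOneSpectrum NumberField
  Literature.NumberTheory.EllipticCurves
  Summit.BirchSwinnertonDyer.BirchSwinnertonDyer.Theorems.GoldfeldGoodTwists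

namespace Summit.BirchSwinnertonDyer.BirchSwinnertonDyer.Theorems.PrintCf2.TamagawaPlaces

/-! ## §3. Every member: `#T + 2 = v₂ Tam(W)` without `7 ∤ d` -/

section Frame

open Summit.BirchSwinnertonDyer.BirchSwinnertonDyer.Theorems.PrintCf2.AdditiveAtSeven
open Summit.BirchSwinnertonDyer.BirchSwinnertonDyer.Theorems.PrintCf2.ReductionTypesOverK
open Summit.BirchSwinnertonDyer.BirchSwinnertonDyer.Theorems.PrintCf2.RestrictedSelmerPair

variable (K : Type) [Field K] [NumberField K]

/-- **`v₂ Tam(W) = 3 + Σ_{ℓ ∈ primeFactors|d| ∖ {2,7}} (1 | 2)` for EVERY model `W` of `cm7^{(d)}`** (`d` squarefree, `d ≢ 1 (mod 4)`; NO condition at `7`):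
c301's law for `7 ∤ d` (where erasing `7` is vacuous) and §2 for `7 ∣ d`. [cite: Silverman1994, IV.9.4 and Table 4.1] -/
theorem padicValNat_two_tamagawaProduct_eq {d : ℤ} (hsq : Squarefree d) (hd4 : d % 4 ≠ 1)
    (W : WeierstrassCurve ℚ) [W.IsElliptic] (C : VariableChange ℚ) (hC : C • W = cm7.quadraticTwist (d : ℚ)) :
    padicValNat 2 W.tamagawaProduct =
      3 + ∑ ℓ ∈ (d.natAbs.primeFactors.erase 2).erase 7, (if jacobiSym ℓ 7 = -1 then 1 else 2) := by
  have hprod : (∏ l ∈ (d.natAbs.primeFactors.erase 2).erase 7, (if jacobiSym l 7 = -1 then 2 else 4 : ℕ)) =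
      2 ^ ∑ ℓ ∈ (d.natAbs.primeFactors.erase 2).erase 7, (if jacobiSym ℓ 7 = -1 then 1 else 2) := by
    rw [← Finset.prod_pow_eq_pow_sum]
    refine Finset.prod_congr rfl fun ℓ _ ↦ ?_
    split_ifs <;> norm_num
  by_cases h7 : (7 : ℤ) ∣ d
  · rw [tamagawaProduct_eq_of_smul_eq_cm7_quadraticTwist_of_dvd hsq hd4 h7 W C hC, hprod,
      show (8 : ℕ) = 2 ^ 3 by norm_num, ← pow_add, padicValNat.prime_pow]
  · have h7Q : (7 : ℕ) ∉ d.natAbs.primeFactors.erase 2 := by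
      intro h
      exact h7 (Int.natCast_dvd.mpr (Nat.dvd_of_mem_primeFactors (Finset.mem_of_mem_erase h)))
    have herase : (d.natAbs.primeFactors.erase 2).erase 7 = d.natAbs.primeFactors.erase 2 := Finset.erase_eq_of_notMem h7Q
    rw [herase]
    exact padicValNat_two_tamagawaProduct_of_frame hsq hd4 h7 W C hC

/-- **`#T = 1 + Σ_{ℓ ∈ primeFactors|d| ∖ {2,7}} (1 | 2)`** for `T = {w : 2 ∉ w, 7d ∈ w}` (`d ≠ 0`, NO condition at `7`) over a quadratic `K` with
`d_K = −7`: the primes above the odd primes of `7d` are one above `7` and `1` or `2` above each odd `ℓ ∣ d`, `ℓ ≠ 7`, by `(ℓ/7)`.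
[cite: Marcus2018, Ch. 3 Thm. 25] [cite: Agboola2007, §6] -/
theorem card_places_seven_mul_eq_erase {d : ℤ} (hd0 : d ≠ 0) (hK2 : Module.finrank ℚ K = 2)
    (hdisc : NumberField.discr K = -7) (T : Finset (HeightOneSpectrum (𝓞 K)))
    (hT : ∀ w : HeightOneSpectrum (𝓞 K), w ∈ T ↔ ((2 : ℕ) : 𝓞 K) ∉ w.asIdeal ∧ ((7 * d : ℤ) : 𝓞 K) ∈ w.asIdeal) :
    T.card = 1 + ∑ ℓ ∈ (d.natAbs.primeFactors.erase 2).erase 7, (if jacobiSym ℓ 7 = -1 then 1 else 2) := by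
  set S : Finset ℕ := insert 7 ((d.natAbs.primeFactors.erase 2).erase 7) with hS
  have hSprime : ∀ ℓ ∈ S, ℓ.Prime := by
    intro ℓ hℓ
    rcases Finset.mem_insert.mp hℓ with rfl | hℓ
    · norm_num
    · exact Nat.prime_of_mem_primeFactors (Finset.mem_of_mem_erase (Finset.mem_of_mem_erase hℓ))
  have h7S : (7 : ℕ) ∉ (d.natAbs.primeFactors.erase 2).erase 7 := Finset.notMem_erase 7 _
  have hmem : ∀ w : HeightOneSpectrum (𝓞 K), w ∈ T ↔ ∃ ℓ ∈ S, ((ℓ : ℕ) : 𝓞 K) ∈ w.asIdeal := by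
    intro w
    rw [hT]
    constructor
    · rintro ⟨h2w, h7d⟩
      have e : ((7 * d : ℤ) : 𝓞 K) = ((7 : ℕ) : 𝓞 K) * ((d : ℤ) : 𝓞 K) := by push_cast; ring
      rw [e] at h7d
      rcases w.isPrime.mem_or_mem h7d with h | h
      · exact ⟨7, Finset.mem_insert_self _ _, h⟩
      · by_cases hℓ7 : natGenerator (w.under (𝓞 ℚ)) = 7
        · exact ⟨7, Finset.mem_insert_self _ _, hℓ7 ▸ natCast_natGenerator_mem K w⟩
        refine ⟨natGenerator (w.under (𝓞 ℚ)), Finset.mem_insert_of_mem ?_, natCast_natGenerator_mem K w⟩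
        have hℓp : (natGenerator (w.under (𝓞 ℚ))).Prime := prime_natGenerator _
        have hℓd : ((natGenerator (w.under (𝓞 ℚ)) : ℕ) : ℤ) ∣ d := natGenerator_dvd_of_intCast_mem w h
        have hℓ2 : natGenerator (w.under (𝓞 ℚ)) ≠ 2 := fun h2 ↦ h2w (h2 ▸ natCast_natGenerator_mem K w)
        exact Finset.mem_erase.mpr ⟨hℓ7, Finset.mem_erase.mpr
          ⟨hℓ2, Nat.mem_primeFactors.mpr ⟨hℓp, Int.natCast_dvd.mp hℓd, Int.natAbs_ne_zero.mpr hd0⟩⟩⟩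
    · rintro ⟨ℓ, hℓS, hℓw⟩
      have hℓp := hSprime ℓ hℓS
      have hℓ2 : ℓ ≠ 2 := by
        rcases Finset.mem_insert.mp hℓS with rfl | hℓ
        · norm_num
        · exact (Finset.mem_erase.mp (Finset.mem_erase.mp hℓ).2).1
      have hℓdvd : (ℓ : ℤ) ∣ 7 * d := by
        rcases Finset.mem_insert.mp hℓS with rfl | hℓ
        · exact dvd_mul_right _ _
        · exact (Int.natCast_dvd.mpr (Nat.dvd_of_mem_primeFactors
            (Finset.mem_of_mem_erase (Finset.mem_of_mem_erase hℓ)))).mul_left _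
      refine ⟨fun h2 ↦ hℓ2 (eq_of_natCast_mem_of_natCast_mem K hℓp Nat.prime_two w hℓw h2), ?_⟩
      obtain ⟨k, hk⟩ := hℓdvd
      have e : ((7 * d : ℤ) : 𝓞 K) = ((ℓ : ℕ) : 𝓞 K) * ((k : ℤ) : 𝓞 K) := by rw [hk]; push_cast; ring
      rw [e]
      exact w.asIdeal.mul_mem_right _ hℓw
  rw [card_eq_sum_ncard_primesOver K S hSprime T hmem, hS, Finset.sum_insert h7S]
  haveI : Fact (Nat.Prime 7) := ⟨by norm_num⟩
  rw [ncard_primesOver_eq_one_of_dvd_discr K hK2 (p := 7) (by norm_num) (by rw [hdisc]; norm_num)]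
  congr 1
  refine Finset.sum_congr rfl fun ℓ hℓ ↦ ?_
  obtain ⟨hℓ7, hℓ'⟩ := Finset.mem_erase.mp hℓ
  obtain ⟨hℓ2, hℓpf⟩ := Finset.mem_erase.mp hℓ'
  exact ncard_primesOver_eq_of_discr_eq_neg_seven K hK2 hdisc (Nat.prime_of_mem_primeFactors hℓpf) hℓ2 hℓ7

/-- **`#T + 2 = v₂ Tam(W)` on EVERY frame** (member `C • W = cm7^{(d)}`, `d` squarefree, `d ≢ 1 (mod 4)`, with or without `7 ∣ d`; `K` imaginary
quadratic with `θ² = −7`; `T = {w : 2 ∉ w, 7d ∈ w}`): p663318's `card_places_add_two_eq_padicValNat_tamagawaProduct` with the hypothesis `7 ∤ d`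
removed. [cite: Agboola2007, §6] [cite: GreenbergLNM1716, §3 Lemma 3.3 and p. 88] -/
theorem card_places_add_two_eq_padicValNat_tamagawaProduct' {d : ℤ} (hsq : Squarefree d) (hd4 : d % 4 ≠ 1)
    (W : WeierstrassCurve ℚ) [W.IsElliptic] (C : VariableChange ℚ) (hC : C • W = cm7.quadraticTwist (d : ℚ))
    (hK : IsImaginaryQuadratic K) {θ : K} (hθ : θ ^ 2 = -7) (T : Finset (HeightOneSpectrum (𝓞 K)))
    (hT : ∀ w : HeightOneSpectrum (𝓞 K), w ∈ T ↔ ((2 : ℕ) : 𝓞 K) ∉ w.asIdeal ∧ ((7 * d : ℤ) : 𝓞 K) ∈ w.asIdeal) :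
    T.card + 2 = padicValNat 2 W.tamagawaProduct := by
  have hd0 : d ≠ 0 := hsq.ne_zero
  rw [padicValNat_two_tamagawaProduct_eq hsq hd4 W C hC,
    card_places_seven_mul_eq_erase K hd0 hK.1 (discr_eq_neg_seven_of_sq_eq K hK hθ hd0 W hC) T hT]
  ring

/-- **`v₂ [𝔖_{v̄}(K*_∞, W*)^Γ : res 𝔖_{v̄}(K, W*)] ≤ v₂ Tam(W)` on EVERY S3c frame** (p663318's bound with `7 ∤ d` removed). Member
`C • W = cm7^{(d)}` (`d` squarefree, `d ≢ 1 (mod 4)`), `K` imaginary quadratic, `v ≠ v̄` over `2`, `π ∈ End_K(E_K)` with `π² = π − 2`, `r² = r − 2`,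
`κ'` unramified outside `v̄` with topological generator `γ'`. [cite: Agboola2007, §3 Prop. 3.2, §6] [cite: GreenbergLNM1716, §3 Lemmas 3.1–3.3] -/
theorem padicValNat_two_relIndex_control_of_frame_le_tamagawaProduct' {d : ℤ} (hsq : Squarefree d) (hd4 : d % 4 ≠ 1)
    (W : WeierstrassCurve ℚ) [W.IsElliptic] (C : VariableChange ℚ) (hC : C • W = cm7.quadraticTwist (d : ℚ))
    (hK : IsImaginaryQuadratic K) {v vbar : HeightOneSpectrum (𝓞 K)} (hv : ((2 : ℕ) : 𝓞 K) ∈ v.asIdeal)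
    (hvbar : ((2 : ℕ) : 𝓞 K) ∈ vbar.asIdeal) (hne : vbar ≠ v) (π : (W.baseChange K).endRing)
    (hrel : (π : AddMonoid.End (W.baseChange K).geomPoints) * π = π - 2) {r : ℤ_[2]} (hr : r * r = r - 2)
    (κ' : ZpExtension K 2) (hκ' : κ'.IsUnramifiedOutside vbar) {γ' : Field.absoluteGaloisGroup K} (hγ' : κ'.IsTopGenerator γ') :
    padicValNat 2 ((((Agboola2007.restrictedSelmerBase ↥((W.baseChange K).endEigenPrimaryTorsion 2 π r) 2 vbar).map
        (resOfLe ↥((W.baseChange K).endEigenPrimaryTorsion 2 π r) (le_top : κ'.kerSubgroup ≤ ⊤))).addSubgroupOf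
        (Agboola2007.restrictedSelmerZp κ' ↥((W.baseChange K).endEigenPrimaryTorsion 2 π r) vbar)).relIndex
      (IwasawaDual.endInvariants (Agboola2007.conjRestricted κ' ↥((W.baseChange K).endEigenPrimaryTorsion 2 π r) vbar γ' - 1))) ≤
      padicValNat 2 W.tamagawaProduct := by
  have hd0 : d ≠ 0 := hsq.ne_zero
  have hj : W.j = -3375 := j_eq_of_smul_eq_cm7Twist hd0 W C hC
  obtain ⟨θ, hθ⟩ := exists_sq_eq_neg_seven_of_cmEndo_mem_endRing W K hj π hrel
  obtain ⟨T, hT⟩ := exists_finset_seven_mul (K := K) hd0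
  have h := padicValNat_two_relIndex_control_of_frame_le hd0 hsq W C hC hK hv hvbar hne π hrel hr κ' hκ' hγ' T hT
  rwa [card_places_add_two_eq_padicValNat_tamagawaProduct' K hsq hd4 W C hC hK hθ T hT] at h

/-- **`Σ_{w ∈ T} v₂ #LK_w + 2 = v₂ Tam(W)` EXACTLY on EVERY frame**, granted (C1) «no `w ∈ T` splits completely in `K*_∞`» (displayed hypothesis
`hC1`): p663318's `sum_padicValNat_localKer_top_of_frame_add_two_eq` with `7 ∤ d` removed. [cite: GreenbergLNM1716, §3 Lemma 3.3 and p. 88]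
[cite: Agboola2007, §3 Prop. 3.2, §6] -/
theorem sum_padicValNat_localKer_top_of_frame_add_two_eq' {d : ℤ} (hsq : Squarefree d) (hd4 : d % 4 ≠ 1)
    (W : WeierstrassCurve ℚ) [W.IsElliptic] (C : VariableChange ℚ) (hC : C • W = cm7.quadraticTwist (d : ℚ))
    (hK : IsImaginaryQuadratic K) (vbar : HeightOneSpectrum (𝓞 K)) (hvbar : ((2 : ℕ) : 𝓞 K) ∈ vbar.asIdeal)
    (π : (W.baseChange K).endRing) (hrel : (π : AddMonoid.End (W.baseChange K).geomPoints) * π = π - 2)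
    {r : ℤ_[2]} (hr : r * r = r - 2) (κ' : ZpExtension K 2) (hκ' : κ'.IsUnramifiedOutside vbar)
    (T : Finset (HeightOneSpectrum (𝓞 K)))
    (hT : ∀ w : HeightOneSpectrum (𝓞 K), w ∈ T ↔ ((2 : ℕ) : 𝓞 K) ∉ w.asIdeal ∧ ((7 * d : ℤ) : 𝓞 K) ∈ w.asIdeal)
    (hC1 : ∀ w ∈ T, ¬ GreenbergSelmer.decomp w ≤ κ'.kerSubgroup) :
    (∑ w ∈ T, padicValNat 2 (Nat.card (resOfLe ↥((W.baseChange K).endEigenPrimaryTorsion 2 π r)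
        (inf_le_inf_right (GreenbergSelmer.decomp w) (le_top : κ'.kerSubgroup ≤ ⊤))).ker)) + 2 =
      padicValNat 2 W.tamagawaProduct := by
  have hd0 : d ≠ 0 := hsq.ne_zero
  have hj : W.j = -3375 := j_eq_of_smul_eq_cm7Twist hd0 W C hC
  obtain ⟨θ, hθ⟩ := exists_sq_eq_neg_seven_of_cmEndo_mem_endRing W K hj π hrel
  have hsum : (∑ w ∈ T, padicValNat 2 (Nat.card (resOfLe ↥((W.baseChange K).endEigenPrimaryTorsion 2 π r)
      (inf_le_inf_right (GreenbergSelmer.decomp w) (le_top : κ'.kerSubgroup ≤ ⊤))).ker)) = T.card := by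
    rw [Finset.card_eq_sum_ones]
    refine Finset.sum_congr rfl fun w hw ↦ ?_
    obtain ⟨h2w, h7d⟩ := (hT w).mp hw
    rw [(natCard_localKer_top_of_frame_eq_two hd0 hsq W C hC hK vbar hvbar π hrel hr κ' hκ' h2w h7d (hC1 w hw)).2]
    simp
  rw [hsum]
  exact card_places_add_two_eq_padicValNat_tamagawaProduct' K hsq hd4 W C hC hK hθ T hT

end Frame

/-! ## §4. Unconditional forms: (C1) is a theorem (`…LineNoSplitPrimes`) -/

section Unconditional

open Summit.BirchSwinnertonDyer.BirchSwinnertonDyer.Theorems.PrintCf2.LineDecomposition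
open Summit.BirchSwinnertonDyer.BirchSwinnertonDyer.Theorems.PrintCf2.RestrictedSelmerPair

variable {K : Type} [Field K] [NumberField K]

/-- **On an S3c frame no place `w ∤ 2` splits completely in `K*_∞`** (this seat's idelic theorem
`decomp_not_le_kerSubgroup_of_isUnramifiedOutside`, with `w ≠ v̄` because `2 ∈ v̄`, `2 ∉ w`). `K` imaginary quadratic, `v ≠ v̄` above `2`, `κ'`
unramified outside `v̄`. [cite: deShalit1987, Ch. II §1.1] [cite: Brink2007, Thm. 2] -/
theorem frame_not_decomp_le_kerSubgroup (hK : IsImaginaryQuadratic K) {v vbar : HeightOneSpectrum (𝓞 K)}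
    (hv : ((2 : ℕ) : 𝓞 K) ∈ v.asIdeal) (hvbar : ((2 : ℕ) : 𝓞 K) ∈ vbar.asIdeal) (hne : vbar ≠ v)
    (κ' : ZpExtension K 2) (hκ' : κ'.IsUnramifiedOutside vbar) {w : HeightOneSpectrum (𝓞 K)}
    (h2w : ((2 : ℕ) : 𝓞 K) ∉ w.asIdeal) : ¬ GreenbergSelmer.decomp w ≤ κ'.kerSubgroup :=
  decomp_not_le_kerSubgroup_of_isUnramifiedOutside hK hv hvbar hne κ' hκ' (fun h ↦ h2w (h ▸ hvbar))

/-- **`#LK_w = 2` EXACTLY at every `w ∤ 2` with `7d ∈ w`, on every S3c frame — UNCONDITIONALLY** (p662395's `natCard_localKer_top_of_frame_eq_two`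
with its hypothesis `¬ decomp w ≤ κ'.kerSubgroup` DISCHARGED by (C1)). Member `C • W = cm7^{(d)}` (`d ≠ 0` squarefree), `K` imaginary quadratic,
`v ≠ v̄` the places above `2`, `π ∈ End_K(E_K)` with `π² = π − 2`, `r² = r − 2`, `κ'` unramified outside `v̄`.
[cite: GreenbergLNM1716, §3 Lemma 3.3 (p. 88)] [cite: Agboola2007, §3 Prop. 3.2, §6] -/
theorem natCard_localKer_top_of_frame_eq_two' {d : ℤ} (hd0 : d ≠ 0) (hsq : Squarefree d)
    (W : WeierstrassCurve ℚ) [W.IsElliptic] (C : VariableChange ℚ) (hC : C • W = cm7.quadraticTwist (d : ℚ))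
    (hK : IsImaginaryQuadratic K) {v vbar : HeightOneSpectrum (𝓞 K)} (hv : ((2 : ℕ) : 𝓞 K) ∈ v.asIdeal)
    (hvbar : ((2 : ℕ) : 𝓞 K) ∈ vbar.asIdeal) (hne : vbar ≠ v)
    (π : (W.baseChange K).endRing) (hrel : (π : AddMonoid.End (W.baseChange K).geomPoints) * π = π - 2)
    {r : ℤ_[2]} (hr : r * r = r - 2) (κ' : ZpExtension K 2) (hκ' : κ'.IsUnramifiedOutside vbar)
    {w : HeightOneSpectrum (𝓞 K)} (h2w : ((2 : ℕ) : 𝓞 K) ∉ w.asIdeal) (h7d : ((7 * d : ℤ) : 𝓞 K) ∈ w.asIdeal) :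
    Finite (resOfLe ↥((W.baseChange K).endEigenPrimaryTorsion 2 π r)
        (inf_le_inf_right (GreenbergSelmer.decomp w) (le_top : κ'.kerSubgroup ≤ ⊤))).ker ∧
      Nat.card (resOfLe ↥((W.baseChange K).endEigenPrimaryTorsion 2 π r)
        (inf_le_inf_right (GreenbergSelmer.decomp w) (le_top : κ'.kerSubgroup ≤ ⊤))).ker = 2 :=
  natCard_localKer_top_of_frame_eq_two hd0 hsq W C hC hK vbar hvbar π hrel hr κ' hκ' h2w h7d
    (frame_not_decomp_le_kerSubgroup hK hv hvbar hne κ' hκ' h2w)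

/-- **`∏_{w ∈ T} #LK_w = 2^{#T}` UNCONDITIONALLY** on every S3c frame (`T = {w : 2 ∉ w, 7d ∈ w}`). [cite: GreenbergLNM1716, §3 Lemma 3.3 (p. 88)] -/
theorem prod_natCard_localKer_top_of_frame_eq_two_pow' {d : ℤ} (hd0 : d ≠ 0) (hsq : Squarefree d)
    (W : WeierstrassCurve ℚ) [W.IsElliptic] (C : VariableChange ℚ) (hC : C • W = cm7.quadraticTwist (d : ℚ))
    (hK : IsImaginaryQuadratic K) {v vbar : HeightOneSpectrum (𝓞 K)} (hv : ((2 : ℕ) : 𝓞 K) ∈ v.asIdeal)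
    (hvbar : ((2 : ℕ) : 𝓞 K) ∈ vbar.asIdeal) (hne : vbar ≠ v)
    (π : (W.baseChange K).endRing) (hrel : (π : AddMonoid.End (W.baseChange K).geomPoints) * π = π - 2)
    {r : ℤ_[2]} (hr : r * r = r - 2) (κ' : ZpExtension K 2) (hκ' : κ'.IsUnramifiedOutside vbar)
    (T : Finset (HeightOneSpectrum (𝓞 K)))
    (hT : ∀ w : HeightOneSpectrum (𝓞 K), w ∈ T ↔ ((2 : ℕ) : 𝓞 K) ∉ w.asIdeal ∧ ((7 * d : ℤ) : 𝓞 K) ∈ w.asIdeal) :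
    ∏ w ∈ T, Nat.card (resOfLe ↥((W.baseChange K).endEigenPrimaryTorsion 2 π r)
        (inf_le_inf_right (GreenbergSelmer.decomp w) (le_top : κ'.kerSubgroup ≤ ⊤))).ker = 2 ^ T.card :=
  prod_natCard_localKer_top_of_frame_eq_two_pow hd0 hsq W C hC hK vbar hvbar π hrel hr κ' hκ' T hT
    (fun w hw ↦ frame_not_decomp_le_kerSubgroup hK hv hvbar hne κ' hκ' ((hT w).mp hw).1)

/-- **THE ODD LOCAL KERNELS ARE S3c's TAMAGAWA TERM, UNCONDITIONALLY: `Σ_{w ∈ T} v₂ #LK_w + 2 = v₂ Tam(W)`** on EVERY S3c frame — member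
`C • W = cm7^{(d)}` (`d` squarefree, `d ≢ 1 (mod 4)`, with or without `7 ∣ d`), `K` imaginary quadratic, `v ≠ v̄` the places above `2`,
`π ∈ End_K(E_K)` with `π² = π − 2`, `r² = r − 2`, `κ'` unramified outside `v̄`, `T = {w : 2 ∉ w, 7d ∈ w}`; NO displayed hypothesis (the class-field
input (C1) is `decomp_not_le_kerSubgroup_of_isUnramifiedOutside`; the `7 ∣ d` members are file 1). Greenberg's «`∏_{w∣ℓ} #ker r_w = c_ℓ^{(p)}`»
summed over the odd bad primes, for the summand `W*`. [cite: GreenbergLNM1716, §3 Lemma 3.3 and p. 88] [cite: Agboola2007, §3 Prop. 3.2, §6] -/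
theorem sum_padicValNat_localKer_top_of_frame_add_two_eq'' {d : ℤ} (hsq : Squarefree d) (hd4 : d % 4 ≠ 1)
    (W : WeierstrassCurve ℚ) [W.IsElliptic] (C : VariableChange ℚ) (hC : C • W = cm7.quadraticTwist (d : ℚ))
    (hK : IsImaginaryQuadratic K) {v vbar : HeightOneSpectrum (𝓞 K)} (hv : ((2 : ℕ) : 𝓞 K) ∈ v.asIdeal)
    (hvbar : ((2 : ℕ) : 𝓞 K) ∈ vbar.asIdeal) (hne : vbar ≠ v)
    (π : (W.baseChange K).endRing) (hrel : (π : AddMonoid.End (W.baseChange K).geomPoints) * π = π - 2)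
    {r : ℤ_[2]} (hr : r * r = r - 2) (κ' : ZpExtension K 2) (hκ' : κ'.IsUnramifiedOutside vbar)
    (T : Finset (HeightOneSpectrum (𝓞 K)))
    (hT : ∀ w : HeightOneSpectrum (𝓞 K), w ∈ T ↔ ((2 : ℕ) : 𝓞 K) ∉ w.asIdeal ∧ ((7 * d : ℤ) : 𝓞 K) ∈ w.asIdeal) :
    (∑ w ∈ T, padicValNat 2 (Nat.card (resOfLe ↥((W.baseChange K).endEigenPrimaryTorsion 2 π r)
        (inf_le_inf_right (GreenbergSelmer.decomp w) (le_top : κ'.kerSubgroup ≤ ⊤))).ker)) + 2 =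
      padicValNat 2 W.tamagawaProduct :=
  sum_padicValNat_localKer_top_of_frame_add_two_eq' K hsq hd4 W C hC hK vbar hvbar π hrel hr κ' hκ' T hT
    (fun w hw ↦ frame_not_decomp_le_kerSubgroup hK hv hvbar hne κ' hκ' ((hT w).mp hw).1)

end Unconditional

/-! ## §5. LEAD g12's cut 4: the hypotheses (C1-split) and (R-SEVEN), verbatim -/

section Cut4

open Summit.BirchSwinnertonDyer.BirchSwinnertonDyer.Theorems.PrintCf2.LineDecomposition

/-- **(C1-split) of cut 4, VERBATIM** (`restrictedControl_two_of_residuals_split_places`, hypothesis `hC1`): discharged by this seat's idelic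
theorem `decomp_not_le_kerSubgroup_of_isUnramifiedOutside` (`2 ∈ v̄`, `2 ∉ w` ⟹ `w ≠ v̄`). [cite: deShalit1987, Ch. II §1.1] [cite: Brink2007, Thm. 2] -/
theorem c1_split_cut4 :
    ∀ (K : Type) [Field K] [NumberField K], IsImaginaryQuadratic K →
      ∀ (v vbar : HeightOneSpectrum (𝓞 K)),
        ((2 : ℕ) : 𝓞 K) ∈ v.asIdeal → ((2 : ℕ) : 𝓞 K) ∈ vbar.asIdeal → vbar ≠ v →
      ∀ (κ' : ZpExtension K 2), κ'.IsUnramifiedOutside vbar →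
      ∀ (w : HeightOneSpectrum (𝓞 K)), ((2 : ℕ) : 𝓞 K) ∉ w.asIdeal → ¬ GreenbergSelmer.decomp w ≤ κ'.kerSubgroup :=
  fun _ _ _ hK _ _ hv hvbar hne κ' hκ' _ h2w ↦
    decomp_not_le_kerSubgroup_of_isUnramifiedOutside hK hv hvbar hne κ' hκ' (fun h ↦ h2w (h ▸ hvbar))

/-- **(R-SEVEN) of cut 4, VERBATIM** (hypothesis `hSeven`): for `7 ∣ d`, `#W(ℚ)_tors = 2` (`…TorsionSevenDvd`) and
`Σ_{w ∈ T} v₂ #LK_w + 2 = v₂ Tam(W)` (§3 `sum_padicValNat_localKer_top_of_frame_add_two_eq'`; its `hC1` input is even a theorem, §4).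
[cite: Agboola2007, §6] [cite: GreenbergLNM1716, §3 Lemma 3.3] [cite: Olson1974, Thm. 1] -/
theorem rSeven_cut4 :
    ∀ (d : ℤ), Squarefree d → d % 4 ≠ 1 → (7 : ℤ) ∣ d →
      ∀ (W : WeierstrassCurve ℚ) [W.IsElliptic] (C : VariableChange ℚ), C • W = cm7.quadraticTwist (d : ℚ) →
      W.torsionOrder = 2 ∧
      ∀ (K : Type) [Field K] [NumberField K], IsImaginaryQuadratic K →
      ∀ (vbar : HeightOneSpectrum (𝓞 K)), ((2 : ℕ) : 𝓞 K) ∈ vbar.asIdeal →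
      ∀ (π : (W.baseChange K).endRing), (π : AddMonoid.End (W.baseChange K).geomPoints) * π = π - 2 →
      ∀ (r : ℤ_[2]), r * r = r - 2 → ∀ (κ' : ZpExtension K 2), κ'.IsUnramifiedOutside vbar →
      ∀ (T : Finset (HeightOneSpectrum (𝓞 K))),
        (∀ w : HeightOneSpectrum (𝓞 K), w ∈ T ↔ ((2 : ℕ) : 𝓞 K) ∉ w.asIdeal ∧ ((7 * d : ℤ) : 𝓞 K) ∈ w.asIdeal) →
        (∀ w ∈ T, ¬ GreenbergSelmer.decomp w ≤ κ'.kerSubgroup) →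
        (∑ w ∈ T, padicValNat 2 (Nat.card (resOfLe ↥((W.baseChange K).endEigenPrimaryTorsion 2 π r)
          (inf_le_inf_right (GreenbergSelmer.decomp w) (le_top : κ'.kerSubgroup ≤ ⊤))).ker)) + 2 =
          padicValNat 2 W.tamagawaProduct := by
  intro d hsq hd4 h7 W _ C hC
  refine ⟨torsionOrder_eq_two_of_smul_eq_cm7_quadraticTwist_of_dvd hsq hd4 h7 W C hC, ?_⟩
  intro K _ _ hK vbar hvbar π hrel r hr κ' hκ' T hT hC1
  exact sum_padicValNat_localKer_top_of_frame_add_two_eq' K hsq hd4 W C hC hK vbar hvbar π hrel hr κ' hκ' T hT hC1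

end Cut4

end Summit.BirchSwinnertonDyer.BirchSwinnertonDyer.Theorems.PrintCf2.TamagawaPlaces

end
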